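import Literature.MathematicalPhysics.QuantumLattice.HubbardHubbardModelEtaODLROProofs
import Literature.MathematicalPhysics.QuantumLattice.FermionOperatorsProofs

/-!
# Crux `TwSeededEnsembleEquivalence` (stmt-HubbardSuperconductivity-1698), line `exposed-density-duality` —
# stub `stub_sWavePairFluctuationBound` (structural barrier B1a: Pauli blocking of the on-site pair condensate)

For the on-site `s`-wave pair field `P_s = pairField sWave L` of the fermionic torus `(ℤ/Lℤ)²` and
every Fock vector `ψ` (occupation-number amplitudes `ψ(s)`, `s ⊆ Orb = sites × {↑,↓}`),

  `‖P_s ψ‖² ≤ 2 Σ_s |ψ(s)|² · D(s) · (E(s) + 1)`,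

`D(s)` = number of doubly occupied sites of the configuration `s`, `E(s)` = number of empty sites.
This is the operator inequality `ηᴴ η ≤ D̂ (Ê + 1)` for `η = Σ_x c_{x↓} c_{x↑}` (`P_s = -√2 η`),
the finite-volume "Pauli blocking" bound on the on-site pair condensate.

Proof (elementary, in the Jordan–Wigner matrix model of the tree):
* normal form `P_s = -√2 Σ_x c_{x↓} c_{x↑}` (only the step `e = 0` of `localPair` carries a
  non-zero `sWave` coefficient; `c_{x↑} c_{x↓} = -c_{x↓} c_{x↑}`; the `TorusSite` sum is
  reindexed through `FermionTorus.equivTorusSite`), and the on-site pair annihilator is SIGN-FREE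
  on amplitudes (`EtaPairingODLRO.pairAnnihilation_mulVec_apply`):
  `(η ψ)(s) = Σ_{x empty in s} ψ(s ∪ {x↑, x↓})`;
* Cauchy–Schwarz per configuration: `|(η ψ)(s)|² ≤ E(s) Σ_{x empty in s} |ψ(s ∪ {x↑,x↓})|²`;
* reindexing the double sum through the bijection `s ↦ s ∪ {x↑, x↓}` from the configurations in
  which `x` is empty onto those in which `x` is doubly occupied, under which `E` drops by one:
  `Σ_s E(s) Σ_{x empty in s} |ψ(s ∪ x⇈)|² = Σ_{s'} |ψ(s')|² D(s') (E(s') + 1)`.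

Sources: C. N. Yang, PRL 63 (1989) 2144 (η pairing); the bound itself is folklore bookkeeping.
No definitions are introduced.
-/

-- the tree's layout `Summit.HubbardSuperconductivity.HubbardSuperconductivity.…` repeats a namespace component
set_option linter.dupNamespace false

namespace Summit.HubbardSuperconductivity.HubbardSuperconductivity.Theorems.TwSeededEnsembleEquivalence.ExposedDensity

open Matrix Finset Literature.MathematicalPhysics.QuantumLattice Literature.Probability.LatticeModels
open scoped ComplexOrder Matrix.Norms.L2Operator

noncomputable section

namespace SWavePairFluctuation

open EtaPairingODLRO

/-! ### Linear-algebra helpers -/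

/-- `Re (star v ⬝ᵥ v) = Σ_i ‖v i‖²`. [folklore] -/
theorem re_star_dotProduct_self {ι : Type*} [Fintype ι] (v : ι → ℂ) :
    (star v ⬝ᵥ v).re = ∑ i, ‖v i‖ ^ 2 := by
  simp only [dotProduct, Pi.star_apply, Complex.star_def, Complex.re_sum]
  refine sum_congr rfl fun i _ => ?_
  rw [Complex.conj_mul']
  exact_mod_cast rfl

/-- Cauchy–Schwarz for a finite sum of complex numbers: `‖Σ_{x ∈ A} a x‖² ≤ #A · Σ_{x ∈ A} ‖a x‖²`.
[folklore] -/
theorem norm_sq_sum_le_card_mul {ι : Type*} (A : Finset ι) (a : ι → ℂ) :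
    ‖∑ x ∈ A, a x‖ ^ 2 ≤ (A.card : ℝ) * ∑ x ∈ A, ‖a x‖ ^ 2 :=
  calc ‖∑ x ∈ A, a x‖ ^ 2 ≤ (∑ x ∈ A, ‖a x‖) ^ 2 := by
        gcongr
        exact norm_sum_le _ _
    _ ≤ (A.card : ℝ) * ∑ x ∈ A, ‖a x‖ ^ 2 := sq_sum_le_card_mul_sum_sq

/-! ### Site bookkeeping on the fermionic torus -/

section Combinatorics

variable (L : ℕ)

/-- A sum of `[x↑ ∉ s ∧ x↓ ∉ s]`-guarded terms over all sites is the sum over the empty sites of `s`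
(nested-filter form). [folklore] -/
theorem sum_ite_empty_eq_sum_filter {M : Type*} [AddCommMonoid M] (s : Finset (Orb (FermionTorus 2 L)))
    (f : FermionTorus 2 L → M) :
    ∑ x : FermionTorus 2 L, (if orb x 0 ∉ s ∧ orb x 1 ∉ s then f x else 0) =
      ∑ x ∈ ((univ.filter fun x : FermionTorus 2 L => orb x 0 ∉ s).filter fun x => orb x 1 ∉ s),
        f x := by
  rw [sum_filter, sum_filter]
  exact sum_congr rfl fun x _ => ite_and _ _ _ _

/-- Filling an empty site `x` of a configuration `s` with the pair `{x↑, x↓}` lowers the number of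
empty sites by exactly one (every other site keeps its occupation). [folklore] -/
theorem card_emptySites_eq_succ (x : FermionTorus 2 L) (s : Finset (Orb (FermionTorus 2 L)))
    (h0 : orb x 0 ∉ s) (h1 : orb x 1 ∉ s) :
    ((univ.filter fun y : FermionTorus 2 L => orb y 0 ∉ s).filter fun y => orb y 1 ∉ s).card =
      ((univ.filter fun y : FermionTorus 2 L =>
          orb y 0 ∉ insert (orb x 0) (insert (orb x 1) s)).filter fun y =>
          orb y 1 ∉ insert (orb x 0) (insert (orb x 1) s)).card + 1 := by
  have hx : x ∉ ((univ.filter fun y : FermionTorus 2 L =>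
      orb y 0 ∉ insert (orb x 0) (insert (orb x 1) s)).filter fun y =>
      orb y 1 ∉ insert (orb x 0) (insert (orb x 1) s)) :=
    fun h => (mem_filter.1 (mem_filter.1 h).1).2 (mem_insert_self _ _)
  rw [← card_insert_of_notMem hx]
  refine congrArg Finset.card ?_
  ext y
  simp only [mem_filter, mem_univ, true_and, Finset.mem_insert (s := Finset.filter _ _)]
  constructor
  · rintro ⟨hy0, hy1⟩
    by_cases hxy : y = x
    · exact Or.inl hxy
    · refine Or.inr ⟨?_, ?_⟩
      · simp only [mem_insert, not_or]
        exact ⟨orb_ne_orb_of_ne hxy 0 0, orb_ne_orb_of_ne hxy 0 1, hy0⟩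
      · simp only [mem_insert, not_or]
        exact ⟨orb_ne_orb_of_ne hxy 1 0, orb_ne_orb_of_ne hxy 1 1, hy1⟩
  · rintro (rfl | ⟨hy0, hy1⟩)
    · exact ⟨h0, h1⟩
    · exact ⟨fun h => hy0 (mem_insert_of_mem (mem_insert_of_mem h)),
        fun h => hy1 (mem_insert_of_mem (mem_insert_of_mem h))⟩

/-- For a fixed site `x`, `s ↦ s ∪ {x↑, x↓}` is a bijection from the configurations in which `x` is
empty onto those in which `x` is doubly occupied (inverse: remove the pair), so sums can be
transported along it. [folklore] -/
theorem sum_emptyAt_eq_sum_doublyAt {M : Type*} [AddCommMonoid M] (x : FermionTorus 2 L)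
    (g : Finset (Orb (FermionTorus 2 L)) → M) :
    ∑ s ∈ ((univ.filter fun s : Finset (Orb (FermionTorus 2 L)) => orb x 0 ∉ s).filter
        fun s => orb x 1 ∉ s), g (insert (orb x 0) (insert (orb x 1) s)) =
      ∑ s ∈ ((univ.filter fun s : Finset (Orb (FermionTorus 2 L)) => orb x 0 ∈ s).filter
        fun s => orb x 1 ∈ s), g s := by
  refine sum_nbij' (fun s => insert (orb x 0) (insert (orb x 1) s))
    (fun s => (s.erase (orb x 0)).erase (orb x 1)) ?_ ?_ ?_ ?_ (fun _ _ => rfl)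
  · intro s _
    simp only [mem_filter, mem_univ, true_and]
    exact ⟨mem_insert_self _ _, mem_insert_of_mem (mem_insert_self _ _)⟩
  · intro s _
    simp only [mem_filter, mem_univ, true_and]
    exact ⟨fun h => notMem_erase _ _ (mem_of_mem_erase h), notMem_erase _ _⟩
  · intro s hs
    simp only [mem_filter, mem_univ, true_and] at hs
    have h0 : orb x 0 ∉ insert (orb x 1) s := by
      simp only [mem_insert, not_or]
      exact ⟨orb_zero_ne_orb_one x, hs.1⟩
    simp only [erase_insert h0, erase_insert hs.2]
  · intro s hs
    simp only [mem_filter, mem_univ, true_and] at hs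
    simp only [insert_erase (mem_erase.2 ⟨(orb_zero_ne_orb_one x).symm, hs.2⟩), insert_erase hs.1]

end Combinatorics

/-! ### The on-site pair field in the occupation basis -/

section PairField

variable (L : ℕ) [NeZero L]

/-- **Normal form of the on-site pair field**: `P_s = pairField sWave L = -√2 Σ_x c_{x↓} c_{x↑}`, the
sum running over the fermionic torus (only the step `e = 0` of `localPair` survives,
`c_{x↑} c_{x↓} = -c_{x↓} c_{x↑}`, and the `TorusSite` sum is reindexed along
`FermionTorus.equivTorusSite`). Scalapino, Phys. Rep. 250 (1995) 329, §2. [folklore] -/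
-- adapted from Summits/HubbardSuperconductivity/HubbardSuperconductivity/Theorems/EnslavedA1gIdentity.lean
theorem pairField_sWave_eq_smul_sum :
    pairField sWave L = (-((Real.sqrt 2 : ℝ) : ℂ)) •
      ∑ x : FermionTorus 2 L, annihilation (orb x 1) * annihilation (orb x 0) := by
  have hr : (1 / Real.sqrt 2 : ℝ) * 2 = Real.sqrt 2 := by rw [one_div_mul_eq_div, Real.div_sqrt]
  have hc : ((1 / Real.sqrt 2 : ℝ) : ℂ) * 2 = ((Real.sqrt 2 : ℝ) : ℂ) := by exact_mod_cast hr
  have hp : Torus.proj L (0 : Site 2) = 0 := by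
    funext i
    simp [Torus.proj]
  have h1 : ∀ x : TorusSite 2 L, localPair sWave L x = (-((Real.sqrt 2 : ℝ) : ℂ)) •
      (annihilation (orb (FermionTorus.ofTorusSite x) 1) *
        annihilation (orb (FermionTorus.ofTorusSite x) 0)) := by
    intro x
    unfold localPair
    rw [sum_eq_single_of_mem (0 : Site 2) (mem_insert_self _ _)]
    · have h0 : sWave 0 = 1 := if_pos rfl
      rw [h0, hp, add_zero, eq_neg_of_add_eq_zero_left (annihilation_anticommute_holds
        (orb (FermionTorus.ofTorusSite x) 0) (orb (FermionTorus.ofTorusSite x) 1)), ← neg_add',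
        ← two_smul ℂ, smul_neg, smul_smul, hc, ← neg_smul]
    · intro e _ hne
      have : sWave e = 0 := if_neg hne
      simp [this]
  calc pairField sWave L = ∑ x : TorusSite 2 L, (-((Real.sqrt 2 : ℝ) : ℂ)) •
      (annihilation (orb (FermionTorus.ofTorusSite x) 1) *
        annihilation (orb (FermionTorus.ofTorusSite x) 0)) := by
        unfold pairField
        exact sum_congr rfl fun x _ => h1 x
    _ = ∑ x : FermionTorus 2 L, (-((Real.sqrt 2 : ℝ) : ℂ)) •
      (annihilation (orb x 1) * annihilation (orb x 0)) :=
        Equiv.sum_comp FermionTorus.equivTorusSite.symm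
          (fun x : FermionTorus 2 L => (-((Real.sqrt 2 : ℝ) : ℂ)) •
            (annihilation (orb x 1) * annihilation (orb x 0)))
    _ = _ := (smul_sum ..).symm

/-- `P_s ψ` in the occupation basis: `(P_s ψ)(s) = -√2 Σ_{x empty in s} ψ(s ∪ {x↑, x↓})` (the
on-site pair annihilator is sign-free on amplitudes). Yang, PRL 63 (1989) 2144, eq. (4). [folklore] -/
theorem pairField_sWave_mulVec_apply (ψ : Fock (Orb (FermionTorus 2 L)))
    (s : Finset (Orb (FermionTorus 2 L))) :
    (pairField sWave L *ᵥ ψ) s = (-((Real.sqrt 2 : ℝ) : ℂ)) *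
      ∑ x : FermionTorus 2 L, (if orb x 0 ∉ s ∧ orb x 1 ∉ s then
        ψ (insert (orb x 0) (insert (orb x 1) s)) else 0) := by
  rw [pairField_sWave_eq_smul_sum, smul_mulVec, Pi.smul_apply, smul_eq_mul, sum_mulVec,
    Finset.sum_apply]
  congr 1
  refine sum_congr rfl fun x _ => ?_
  rw [pairAnnihilation_mulVec_apply]
  -- the two sides now differ only in the (subsingleton) decidability instances carried by the
  -- generic lemma (`DecidableEq` derived from the linear order) and by the concrete torus
  congr!

/-- Per-configuration bound: `|(P_s ψ)(s)|² ≤ 2 E(s) Σ_{x empty in s} |ψ(s ∪ {x↑, x↓})|²`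
(Cauchy–Schwarz over the `E(s)` empty sites). [folklore] -/
theorem norm_sq_pairField_sWave_mulVec_apply_le (ψ : Fock (Orb (FermionTorus 2 L)))
    (s : Finset (Orb (FermionTorus 2 L))) :
    ‖(pairField sWave L *ᵥ ψ) s‖ ^ 2 ≤
      2 * ((((univ.filter fun x : FermionTorus 2 L => orb x 0 ∉ s).filter
          fun x => orb x 1 ∉ s).card : ℝ) *
        ∑ x ∈ ((univ.filter fun x : FermionTorus 2 L => orb x 0 ∉ s).filter fun x => orb x 1 ∉ s),
          ‖ψ (insert (orb x 0) (insert (orb x 1) s))‖ ^ 2) := by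
  rw [pairField_sWave_mulVec_apply, sum_ite_empty_eq_sum_filter, norm_mul, mul_pow, norm_neg,
    Complex.norm_real, Real.norm_eq_abs, sq_abs, Real.sq_sqrt zero_le_two]
  gcongr
  exact norm_sq_sum_le_card_mul _ _

end PairField

end SWavePairFluctuation

/-- **Stub B1a (Pauli blocking of the on-site pair condensate).** For the on-site `s`-wave pair
field `P_s = pairField sWave L` and every Fock vector `ψ`,
`‖P_s ψ‖² ≤ 2 Σ_s |ψ(s)|² D(s) (E(s) + 1)`, `D(s)`/`E(s)` the numbers of doubly occupied/empty
sites of the configuration `s`; equivalently `ηᴴη ≤ D̂(Ê + 1)` for `η = Σ_x c_{x↓} c_{x↑}`.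
Yang, PRL 63 (1989) 2144 (η pairing); the bound is folklore bookkeeping. [folklore] -/
theorem stub_sWavePairFluctuationBound :
    ∀ (L : ℕ) [NeZero L] (ψ : Fock (Orb (FermionTorus 2 L))),
      (star (pairField sWave L *ᵥ ψ) ⬝ᵥ (pairField sWave L *ᵥ ψ)).re ≤
        2 * ∑ s : Finset (Orb (FermionTorus 2 L)), ‖ψ s‖ ^ 2 *
          ((((Finset.univ.filter fun x : FermionTorus 2 L => orb x 0 ∈ s).filter fun x => orb x 1 ∈ s).card : ℕ) : ℝ) *
          (((((Finset.univ.filter fun x : FermionTorus 2 L => orb x 0 ∉ s).filter fun x => orb x 1 ∉ s).card : ℕ) : ℝ) + 1) := by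
  intro L _ ψ
  -- notation (terms only): `E s` empty-site count, `F s = |ψ s|²`, `ins x s = s ∪ {x↑, x↓}`
  set E : Finset (Orb (FermionTorus 2 L)) → ℝ := fun s =>
    ((((univ.filter fun x : FermionTorus 2 L => orb x 0 ∉ s).filter fun x => orb x 1 ∉ s).card : ℝ))
    with hE
  set F : Finset (Orb (FermionTorus 2 L)) → ℝ := fun s => ‖ψ s‖ ^ 2 with hF
  -- Step 1: per-configuration Cauchy–Schwarz, summed over configurations
  have step1 : (star (pairField sWave L *ᵥ ψ) ⬝ᵥ (pairField sWave L *ᵥ ψ)).re ≤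
      2 * ∑ s : Finset (Orb (FermionTorus 2 L)),
        ∑ x ∈ ((univ.filter fun x : FermionTorus 2 L => orb x 0 ∉ s).filter fun x => orb x 1 ∉ s),
          E s * F (insert (orb x 0) (insert (orb x 1) s)) := by
    rw [SWavePairFluctuation.re_star_dotProduct_self, mul_sum]
    refine sum_le_sum fun s _ => ?_
    refine (SWavePairFluctuation.norm_sq_pairField_sWave_mulVec_apply_le L ψ s).trans (le_of_eq ?_)
    rw [mul_sum]
  -- Step 2: swap the sums (configurations ↔ sites)
  have step2 : ∑ s : Finset (Orb (FermionTorus 2 L)),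
        ∑ x ∈ ((univ.filter fun x : FermionTorus 2 L => orb x 0 ∉ s).filter fun x => orb x 1 ∉ s),
          E s * F (insert (orb x 0) (insert (orb x 1) s)) =
      ∑ x : FermionTorus 2 L,
        ∑ s ∈ ((univ.filter fun s : Finset (Orb (FermionTorus 2 L)) => orb x 0 ∉ s).filter
          fun s => orb x 1 ∉ s), E s * F (insert (orb x 0) (insert (orb x 1) s)) := by
    refine sum_comm' fun s x => ?_
    simp only [mem_filter, mem_univ, true_and, and_true]
  -- Step 3: for each site, transport along `s ↦ s ∪ {x↑, x↓}`; `E` drops by one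
  have step3 : ∀ x : FermionTorus 2 L,
      ∑ s ∈ ((univ.filter fun s : Finset (Orb (FermionTorus 2 L)) => orb x 0 ∉ s).filter
          fun s => orb x 1 ∉ s), E s * F (insert (orb x 0) (insert (orb x 1) s)) =
        ∑ s ∈ ((univ.filter fun s : Finset (Orb (FermionTorus 2 L)) => orb x 0 ∈ s).filter
          fun s => orb x 1 ∈ s), (E s + 1) * F s := by
    intro x
    rw [← SWavePairFluctuation.sum_emptyAt_eq_sum_doublyAt L x (fun s => (E s + 1) * F s)]
    refine sum_congr rfl fun s hs => ?_
    simp only [mem_filter, mem_univ, true_and] at hs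
    simp only [hE, SWavePairFluctuation.card_emptySites_eq_succ L x s hs.1 hs.2, Nat.cast_add,
      Nat.cast_one]
  -- Step 4: swap back and collect the doublon count
  have step4 : ∑ x : FermionTorus 2 L,
        ∑ s ∈ ((univ.filter fun s : Finset (Orb (FermionTorus 2 L)) => orb x 0 ∈ s).filter
          fun s => orb x 1 ∈ s), (E s + 1) * F s =
      ∑ s : Finset (Orb (FermionTorus 2 L)),
        ∑ x ∈ ((univ.filter fun x : FermionTorus 2 L => orb x 0 ∈ s).filter fun x => orb x 1 ∈ s),
          (E s + 1) * F s := by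
    refine sum_comm' fun x s => ?_
    simp only [mem_filter, mem_univ, true_and, and_true]
  calc (star (pairField sWave L *ᵥ ψ) ⬝ᵥ (pairField sWave L *ᵥ ψ)).re
      ≤ 2 * ∑ s : Finset (Orb (FermionTorus 2 L)),
          ∑ x ∈ ((univ.filter fun x : FermionTorus 2 L => orb x 0 ∉ s).filter fun x => orb x 1 ∉ s),
            E s * F (insert (orb x 0) (insert (orb x 1) s)) := step1
    _ = 2 * ∑ s : Finset (Orb (FermionTorus 2 L)),
          ∑ x ∈ ((univ.filter fun x : FermionTorus 2 L => orb x 0 ∈ s).filter fun x => orb x 1 ∈ s),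
            (E s + 1) * F s := by
        rw [step2, sum_congr rfl fun x _ => step3 x, step4]
    _ = _ := by
        congr 1
        refine sum_congr rfl fun s _ => ?_
        rw [sum_const, nsmul_eq_mul, hE, hF]
        ring
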